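import Summits.CriticalPhenomena.SAWScalingLimit.Theorems.SAWDefectDecoherenceBoundaryClosureRLocalL1WeakStar
import Mathlib.MeasureTheory.Integral.RieszMarkovKakutani.Real
import HarnessLib

/-!
# Weak-* subsequential limits of the normalised boundary arrival measures (crux `BoundaryClosureR`,
stmt-CriticalPhenomena-14004, line `polygon-parity-squeeze`, registered sub-goal
`sideMeasure_weakStarLimit` = (A1c) of `stub_polygonIdentification`)

For a FIXED family of domains `Λ δ`, roots `a δ`, normalisers `b δ` and an open `U ⊆ ℂ`, write
`F₀ = F(a δ, ·, x_c, 0)` (spin `0`: a sum of positive weights) and consider the positive, finitely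
supported boundary arrival measures
`λ_δ := δ Σ_{e ∈ ∂Λ_δ} (‖F₀(e)‖ / ‖F₀(b δ)‖) · δ_{δ·mid e}`.
THEOREM (`sideMeasure_weakStarLimit_of_localMass`): if for every compact `K ⊆ U` the mass
`λ_δ(K)` is eventually bounded (hypothesis written as `δ Σ_{δ·mid e ∈ K} ‖F₀(e)‖ ≤ C_K ‖F₀(b δ)‖`),
then every mesh sequence `ns → 0⁺` has a subsequence `ns ∘ ms` and a measure `μ` on `ℂ`, finite on
the compacts of `U`, with `λ_{ns (ms n)}(g) → ∫ g dμ` for every real continuous `g` compactly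
supported in `U`.

Proof: the bookkeeping half is that of the bulk statement
`PickHalfPlane.LocalL1.weakStarLimit_of_localL1` (compact exhaustion `K_m` of `U`; at mesh `ns n`
the functional restricted to `C(K_m, ℝ)` is a finite sum of evaluations of norm `≤ max C_{K_m} 0`
once the mass event holds; ONE diagonal subsequence by sequential Banach–Alaoglu
`Literature.Analysis.FunctionSpaces.exists_strictMono_weakStar_tendsto`; limits glued by
uniqueness), run on the test space `C_c(U, ℝ)`; the limit is a POSITIVE linear functional on
`C_c(U, ℝ)` (`U` is locally compact Hausdorff), represented by the Riesz–Markov–Kakutani measure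
(`RealRMK.rieszMeasure`, `RealRMK.integral_rieszMeasure`), which is regular hence finite on
compacts, and pushed forward to `ℂ` along the inclusion `U ↪ ℂ` (a measurable embedding).
-/

noncomputable section

open scoped BigOperators Topology Classical CompactlySupported ENNReal
open Filter Set MeasureTheory
open Literature.Probability.LatticeModels Literature.Probability.RandomPlanarGeometry
open Literature.Probability.RandomPlanarGeometry.SAW
open Summit.CriticalPhenomena.SAWScalingLimit.Theorems.MassRatio.Negative (hexDomainMidEdges_finite)
open Summit.CriticalPhenomena.SAWScalingLimit.Theorems.PickHalfPlane.LocalL1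
  (exists_compact_exhaustion)

namespace Summit.CriticalPhenomena.SAWScalingLimit.Theorems.PolygonParitySqueeze

/-! ### Helper: finite sums of evaluations on `C(K, ℝ)` -/

/-- **Finite sums of evaluations as a bounded functional on `C(K, ℝ)`** (real version of
`PickHalfPlane.LocalL1.exists_evalFunctional`).  For points `p z` and real coefficients `a z`
(`z ∈ S`) with `Σ_{z ∈ S, p z ∈ K} ‖a z‖ ≤ C`, the functional `f ↦ Σ_{z ∈ S} a z · f(p z)` (terms
with `p z ∉ K` read as `0`) is continuous linear of norm `≤ C`. [folklore] -/
theorem exists_evalFunctional_real {ι : Type*} (K : Set ℂ) [CompactSpace K] (S : Finset ι)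
    (p : ι → ℂ) (a : ι → ℝ) {C : ℝ} (ha : ∑ z ∈ S.filter (fun z => p z ∈ K), ‖a z‖ ≤ C) :
    ∃ T : C(K, ℝ) →L[ℝ] ℝ, (∀ f, ‖T f‖ ≤ C * ‖f‖) ∧
      ∀ f, T f = ∑ z ∈ S, a z * (if h : p z ∈ K then f ⟨p z, h⟩ else 0) := by
  classical
  let Tl : C(K, ℝ) →ₗ[ℝ] ℝ :=
    { toFun := fun f => ∑ z ∈ S, a z * (if h : p z ∈ K then f ⟨p z, h⟩ else 0)
      map_add' := fun f g => by
        rw [← Finset.sum_add_distrib]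
        refine Finset.sum_congr rfl fun z _ => ?_
        split_ifs <;> simp [mul_add]
      map_smul' := fun c f => by
        rw [RingHom.id_apply, smul_eq_mul, Finset.mul_sum]
        refine Finset.sum_congr rfl fun z _ => ?_
        split_ifs
        · simp only [ContinuousMap.smul_apply, smul_eq_mul]; ring
        · simp }
  have hbound : ∀ f : C(K, ℝ), ‖Tl f‖ ≤ C * ‖f‖ := by
    intro f
    have hterm : ∀ z ∈ S, ‖a z * (if h : p z ∈ K then f ⟨p z, h⟩ else 0)‖ ≤
        (if p z ∈ K then ‖a z‖ else 0) * ‖f‖ := by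
      intro z _
      by_cases h : p z ∈ K
      · rw [dif_pos h, if_pos h, norm_mul]
        exact mul_le_mul_of_nonneg_left (f.norm_coe_le_norm _) (norm_nonneg _)
      · rw [dif_neg h, if_neg h]; simp
    calc ‖Tl f‖ ≤ ∑ z ∈ S, ‖a z * (if h : p z ∈ K then f ⟨p z, h⟩ else 0)‖ := norm_sum_le _ _
      _ ≤ ∑ z ∈ S, (if p z ∈ K then ‖a z‖ else 0) * ‖f‖ := Finset.sum_le_sum hterm
      _ = (∑ z ∈ S.filter (fun z => p z ∈ K), ‖a z‖) * ‖f‖ := by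
          rw [← Finset.sum_mul, Finset.sum_filter]
      _ ≤ C * ‖f‖ := mul_le_mul_of_nonneg_right ha (norm_nonneg _)
  exact ⟨Tl.mkContinuous C hbound, fun f => by rw [Tl.mkContinuous_apply]; exact hbound f,
    fun f => rfl⟩

/-! ### The weak-* subsequential limit measure -/

/-- **Weak-* subsequential limits of the normalised boundary arrival measures from local mass
bounds.**  Fix domains `Λ δ`, roots `a δ`, normalisers `b δ`, an open `U ⊆ ℂ`, and write
`F₀ = F(a δ, ·, x_c, 0)`, `λ_δ(g) = δ Σ_{e ∈ ∂Λ_δ} g(δ·mid e) ‖F₀(e)‖ / ‖F₀(b δ)‖`.  If for every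
compact `K ⊆ U` eventually `δ Σ_{e ∈ ∂Λ_δ, δ·mid e ∈ K} ‖F₀(e)‖ ≤ C_K ‖F₀(b δ)‖`, then every mesh
sequence `ns → 0⁺` has a subsequence `ns ∘ ms` and a measure `μ` on `ℂ`, finite on the compacts of
`U`, such that `λ_{ns (ms n)}(g) → ∫ g dμ` for every continuous `g : ℂ → ℝ` compactly supported in
`U`.  Proof: diagonal weak-* extraction on a compact exhaustion of `U` (as in
`PickHalfPlane.LocalL1.weakStarLimit_of_localL1`) giving a positive linear functional on
`C_c(U, ℝ)`, then the Riesz–Markov–Kakutani theorem on the locally compact space `U` and push-forward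
along `U ↪ ℂ`. [folklore] -/
theorem sideMeasure_weakStarLimit_of_localMass (Λ : ℝ → Finset HexVertex)
    (a b : ℝ → Sym2 HexVertex) {U : Set ℂ} (hU : IsOpen U)
    (hM : ∀ K : Set ℂ, IsCompact K → K ⊆ U → ∃ C : ℝ, ∀ᶠ δ : ℝ in 𝓝[>] 0,
      δ * (∑ᶠ e ∈ {e : Sym2 HexVertex | e ∈ hexDomainBoundary (Λ δ) ∧
          (δ : ℂ) * hexMidpoint e ∈ K},
        ‖hexParafermionicObservable (Λ δ) (a δ) hexCriticalFugacity 0 e‖) ≤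
        C * ‖hexParafermionicObservable (Λ δ) (a δ) hexCriticalFugacity 0 (b δ)‖)
    (ns : ℕ → ℝ) (hns : Tendsto ns atTop (𝓝[>] 0)) :
    ∃ ms : ℕ → ℕ, StrictMono ms ∧ ∃ μ : Measure ℂ,
      (∀ K : Set ℂ, IsCompact K → K ⊆ U → μ K < ⊤) ∧
      ∀ g : ℂ → ℝ, Continuous g → HasCompactSupport g → tsupport g ⊆ U →
        Tendsto (fun n => ns (ms n) * ∑ᶠ e ∈ hexDomainBoundary (Λ (ns (ms n))),
          g ((ns (ms n) : ℂ) * hexMidpoint e) *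
            (‖hexParafermionicObservable (Λ (ns (ms n))) (a (ns (ms n))) hexCriticalFugacity 0 e‖ /
              ‖hexParafermionicObservable (Λ (ns (ms n))) (a (ns (ms n))) hexCriticalFugacity 0
                (b (ns (ms n)))‖)) atTop (𝓝 (∫ z, g z ∂μ)) := by
  classical
  haveI : LocallyCompactSpace U := hU.locallyCompactSpace
  ---------------------------------------------------------------- notation
  obtain ⟨Fo, hFo⟩ : ∃ Fo : ℕ → Sym2 HexVertex → ℂ, Fo = fun n e =>
      hexParafermionicObservable (Λ (ns n)) (a (ns n)) hexCriticalFugacity 0 e := ⟨_, rfl⟩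
  obtain ⟨w, hw⟩ : ∃ w : ℕ → Sym2 HexVertex → ℝ, w = fun n e =>
      ‖Fo n e‖ / ‖Fo n (b (ns n))‖ := ⟨_, rfl⟩
  have hw0 : ∀ n e, 0 ≤ w n e := fun n e => by
    rw [hw]; exact div_nonneg (norm_nonneg _) (norm_nonneg _)
  obtain ⟨p, hp⟩ : ∃ p : ℕ → Sym2 HexVertex → ℂ, p = fun n e =>
      ((ns n : ℝ) : ℂ) * hexMidpoint e := ⟨_, rfl⟩
  have hfin : ∀ V : Finset HexVertex, (hexDomainBoundary V).Finite := fun V =>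
    (hexDomainMidEdges_finite V).subset (hexDomainBoundary_subset V)
  obtain ⟨S, hS⟩ : ∃ S : ℕ → Finset (Sym2 HexVertex), S = fun n =>
      (hfin (Λ (ns n))).toFinset := ⟨_, rfl⟩
  have hSmem : ∀ n e, e ∈ S n ↔ e ∈ hexDomainBoundary (Λ (ns n)) := fun n e => by
    rw [hS, Set.Finite.mem_toFinset]
  -- the functionals `lam n` on functions `U → ℝ`
  obtain ⟨lam, hlam⟩ : ∃ lam : ℕ → (U → ℝ) → ℝ, lam = fun n f =>
      ∑ e ∈ S n, ns n * w n e * (if h : p n e ∈ U then f ⟨p n e, h⟩ else 0) := ⟨_, rfl⟩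
  have hlam_add : ∀ n (f g : U → ℝ), lam n (f + g) = lam n f + lam n g := by
    intro n f g
    rw [hlam]
    simp only
    rw [← Finset.sum_add_distrib]
    refine Finset.sum_congr rfl fun e _ => ?_
    split_ifs <;> simp [mul_add]
  have hlam_smul : ∀ n (c : ℝ) (f : U → ℝ), lam n (c • f) = c * lam n f := by
    intro n c f
    rw [hlam]
    simp only
    rw [Finset.mul_sum]
    refine Finset.sum_congr rfl fun e _ => ?_
    split_ifs
    · simp only [Pi.smul_apply, smul_eq_mul]; ring
    · ring
  have hlam_mono : ∀ n, 0 < ns n → ∀ f g : U → ℝ, (∀ x, f x ≤ g x) → lam n f ≤ lam n g := by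
    intro n hn f g hfg
    rw [hlam]
    simp only
    refine Finset.sum_le_sum fun e _ => ?_
    refine mul_le_mul_of_nonneg_left ?_ (mul_nonneg hn.le (hw0 n e))
    split_ifs with h
    · exact hfg _
    · exact le_rfl
  ---------------------------------------------------------------- exhaustion and constants
  obtain ⟨K, hKc, hKU, hKex⟩ := exists_compact_exhaustion hU
  haveI hKcs : ∀ m, CompactSpace (K m) := fun m => isCompact_iff_compactSpace.1 (hKc m)
  choose C hC using fun m => hM (K m) (hKc m) (hKU m)
  obtain ⟨C', hC'⟩ : ∃ C' : ℕ → ℝ, C' = fun m => max (C m) 0 := ⟨_, rfl⟩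
  have hC'0 : ∀ m, 0 ≤ C' m := fun m => by rw [hC']; exact le_max_right _ _
  -- the mass event at mesh `ns n` on `K m`
  obtain ⟨good, hgood⟩ : ∃ good : ℕ → ℕ → Prop, good = fun m n => 0 < ns n ∧
      ns n * ∑ e ∈ (S n).filter (fun e => p n e ∈ K m), ‖Fo n e‖ ≤
        C' m * ‖Fo n (b (ns n))‖ := ⟨_, rfl⟩
  have hpos : ∀ᶠ n in atTop, 0 < ns n :=
    (hns.eventually (self_mem_nhdsWithin (a := (0 : ℝ)) (s := Ioi 0))).mono fun n hn => hn
  have hev : ∀ m, ∀ᶠ n in atTop, good m n := by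
    intro m
    refine ((hns.eventually (hC m)).and hpos).mono fun n hn' => ?_
    obtain ⟨hn, hn0⟩ := hn'
    rw [hgood]
    refine ⟨hn0, ?_⟩
    have hset : {e : Sym2 HexVertex | e ∈ hexDomainBoundary (Λ (ns n)) ∧
        ((ns n : ℝ) : ℂ) * hexMidpoint e ∈ K m} = ↑((S n).filter fun e => p n e ∈ K m) := by
      ext e
      simp only [Set.mem_setOf_eq, Finset.coe_filter, hSmem, hp]
    rw [hset, finsum_mem_coe_finset] at hn
    have h1 : C m * ‖Fo n (b (ns n))‖ ≤ C' m * ‖Fo n (b (ns n))‖ :=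
      mul_le_mul_of_nonneg_right (by rw [hC']; exact le_max_left _ _) (norm_nonneg _)
    have h2 : ns n * ∑ e ∈ (S n).filter (fun e => p n e ∈ K m), ‖Fo n e‖ ≤
        C m * ‖Fo n (b (ns n))‖ := by
      simpa only [hFo] using hn
    exact h2.trans h1
  ---------------------------------------------------------------- the functionals on `C(K m, ℝ)`
  obtain ⟨c, hc⟩ : ∃ c : ℕ → ℕ → Sym2 HexVertex → ℝ, c = fun m n e =>
      if good m n then ns n * w n e else 0 := ⟨_, rfl⟩
  have hcbound : ∀ m n, ∑ e ∈ (S n).filter (fun e => p n e ∈ K m), ‖c m n e‖ ≤ C' m := by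
    intro m n
    rw [hc]
    by_cases hg : good m n
    · simp only [hg, if_true]
      rw [hgood] at hg
      obtain ⟨hn0, hg⟩ := hg
      by_cases hFb : Fo n (b (ns n)) = 0
      · have h0 : ∀ e, w n e = 0 := fun e => by rw [hw]; simp [hFb]
        simp only [h0, mul_zero, norm_zero, Finset.sum_const_zero]
        exact hC'0 m
      · have hFb' : 0 < ‖Fo n (b (ns n))‖ := norm_pos_iff.2 hFb
        have key : ∑ e ∈ (S n).filter (fun e => p n e ∈ K m), ‖ns n * w n e‖ =
            (ns n * ∑ e ∈ (S n).filter (fun e => p n e ∈ K m), ‖Fo n e‖) /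
              ‖Fo n (b (ns n))‖ := by
          rw [Finset.mul_sum, Finset.sum_div]
          refine Finset.sum_congr rfl fun e _ => ?_
          rw [hw, Real.norm_eq_abs, abs_of_nonneg
            (mul_nonneg hn0.le (div_nonneg (norm_nonneg _) (norm_nonneg _)))]
          ring
        rw [key, div_le_iff₀ hFb']
        exact hg
    · simp only [hg, if_false, norm_zero, Finset.sum_const_zero]
      exact hC'0 m
  choose T hTb hTapp using fun m n =>
    exists_evalFunctional_real (K m) (S n) (p n) (c m n) (hcbound m n)
  -- identification with `lam` on test functions supported in `K m`, at good meshes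
  have hident : ∀ m n (f : C_c(U, ℝ)), ((↑) : U → ℂ) '' tsupport f ⊆ K m → good m n →
      T m n (f.toContinuousMap.comp (ContinuousMap.inclusion (hKU m))) = lam n f := by
    intro m n f hf hg
    rw [hTapp, hlam]
    refine Finset.sum_congr rfl fun e _ => ?_
    rw [hc]
    simp only [hg, if_true]
    congr 1
    by_cases h : p n e ∈ K m
    · rw [dif_pos h, dif_pos (hKU m h)]
      rfl
    · rw [dif_neg h]
      by_cases h' : p n e ∈ U
      · rw [dif_pos h']
        refine (image_eq_zero_of_notMem_tsupport fun hmem => h ?_).symm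
        exact hf ⟨⟨p n e, h'⟩, hmem, rfl⟩
      · rw [dif_neg h']
  ---------------------------------------------------------------- extraction
  obtain ⟨φ, hφ, hlim⟩ :=
    Literature.Analysis.FunctionSpaces.exists_strictMono_weakStar_tendsto (𝕜 := ℝ)
      (fun m => C(K m, ℝ)) T C' hC'0 hTb
  choose Lm _hLmb hLmt using hlim
  have hsuppK : ∀ f : C_c(U, ℝ), ∃ m, ((↑) : U → ℂ) '' tsupport f ⊆ K m := fun f =>
    hKex _ (f.hasCompactSupport.image continuous_subtype_val) (Subtype.coe_image_subset _ _)
  have hconvK : ∀ m (f : C_c(U, ℝ)), ((↑) : U → ℂ) '' tsupport f ⊆ K m →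
      Tendsto (fun n => lam (φ n) f) atTop
        (𝓝 (Lm m (f.toContinuousMap.comp (ContinuousMap.inclusion (hKU m))))) := by
    intro m f hf
    refine (hLmt m _).congr' ?_
    filter_upwards [hφ.tendsto_atTop.eventually (hev m)] with n hn
    exact hident m (φ n) f hf hn
  ---------------------------------------------------------------- the limit functional
  obtain ⟨L, hL⟩ : ∃ L : C_c(U, ℝ) → ℝ,
      L = fun f : C_c(U, ℝ) => limUnder atTop (fun n => lam (φ n) f) := ⟨_, rfl⟩
  have hconv : ∀ f : C_c(U, ℝ), Tendsto (fun n => lam (φ n) f) atTop (𝓝 (L f)) := by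
    intro f
    obtain ⟨m, hm⟩ := hsuppK f
    rw [hL]
    exact tendsto_nhds_limUnder ⟨_, hconvK m f hm⟩
  have hLadd : ∀ f g : C_c(U, ℝ), L (f + g) = L f + L g := by
    intro f g
    have h : Tendsto (fun n => lam (φ n) ⇑(f + g)) atTop (𝓝 (L f + L g)) := by
      refine ((hconv f).add (hconv g)).congr fun n => ?_
      rw [CompactlySupportedContinuousMap.coe_add, hlam_add]
    exact tendsto_nhds_unique (hconv (f + g)) h
  have hLsmul : ∀ (r : ℝ) (f : C_c(U, ℝ)), L (r • f) = r * L f := by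
    intro r f
    have h : Tendsto (fun n => lam (φ n) ⇑(r • f)) atTop (𝓝 (r * L f)) := by
      refine ((hconv f).const_mul r).congr fun n => ?_
      rw [CompactlySupportedContinuousMap.coe_smul, hlam_smul]
    exact tendsto_nhds_unique (hconv (r • f)) h
  have hLmono : ∀ f g : C_c(U, ℝ), f ≤ g → L f ≤ L g := by
    intro f g hfg
    refine le_of_tendsto_of_tendsto (hconv f) (hconv g) ?_
    filter_upwards [hφ.tendsto_atTop.eventually hpos] with n hn
    exact hlam_mono (φ n) hn f g (CompactlySupportedContinuousMap.le_def.1 hfg)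
  let Λp : C_c(U, ℝ) →ₚ[ℝ] ℝ :=
    { toFun := L
      map_add' := hLadd
      map_smul' := fun r f => by rw [RingHom.id_apply, smul_eq_mul]; exact hLsmul r f
      monotone' := fun f g hfg => hLmono f g hfg }
  have hΛp : ∀ f, Λp f = L f := fun f => rfl
  ---------------------------------------------------------------- the measure
  refine ⟨φ, hφ, (RealRMK.rieszMeasure Λp).map ((↑) : U → ℂ), ?_, ?_⟩
  · -- finiteness on the compacts of `U`
    intro K₀ hK₀ hK₀U
    rw [Measure.map_apply measurable_subtype_coe hK₀.measurableSet]
    have hcpt : IsCompact (((↑) : U → ℂ) ⁻¹' K₀) := by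
      rw [Topology.IsEmbedding.subtypeVal.isCompact_iff]
      rwa [Set.image_preimage_eq_inter_range, Subtype.range_coe, Set.inter_eq_left.2 hK₀U]
    exact hcpt.measure_lt_top
  · -- convergence on test functions
    intro g hg hgc hgU
    have hgUc : HasCompactSupport (fun x : U => g x) := by
      have h1 : IsCompact (((↑) : U → ℂ) ⁻¹' tsupport g) := by
        rw [Topology.IsEmbedding.subtypeVal.isCompact_iff]
        rwa [Set.image_preimage_eq_inter_range, Subtype.range_coe, Set.inter_eq_left.2 hgU]
      have h2 : tsupport (fun x : U => g x) ⊆ ((↑) : U → ℂ) ⁻¹' tsupport g :=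
        continuous_subtype_val.closure_preimage_subset (Function.support g)
      exact IsCompact.of_isClosed_subset h1 (isClosed_tsupport _) h2
    obtain ⟨gU, hgU'⟩ : ∃ gU : C_c(U, ℝ),
        gU = ⟨⟨fun x : U => g x, hg.comp continuous_subtype_val⟩, hgUc⟩ := ⟨_, rfl⟩
    have hgUapp : ∀ x : U, gU x = g x := fun x => by rw [hgU']; rfl
    -- the sequence is `lam (φ n) gU`
    have hseq : ∀ n, ns (φ n) * ∑ᶠ e ∈ hexDomainBoundary (Λ (ns (φ n))),
        g ((ns (φ n) : ℂ) * hexMidpoint e) *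
          (‖hexParafermionicObservable (Λ (ns (φ n))) (a (ns (φ n))) hexCriticalFugacity 0 e‖ /
            ‖hexParafermionicObservable (Λ (ns (φ n))) (a (ns (φ n))) hexCriticalFugacity 0
              (b (ns (φ n)))‖) = lam (φ n) gU := by
      intro n
      rw [hlam, finsum_mem_eq_finite_toFinset_sum _ (hfin _), Finset.mul_sum]
      simp only [hS]
      refine Finset.sum_congr rfl fun e _ => ?_
      have hgval : (if h : p (φ n) e ∈ U then gU ⟨p (φ n) e, h⟩ else 0) = g (p (φ n) e) := by
        by_cases h : p (φ n) e ∈ U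
        · rw [dif_pos h, hgUapp]
        · rw [dif_neg h]
          exact (image_eq_zero_of_notMem_tsupport fun h' => h (hgU h')).symm
      rw [hgval, hw, hFo, hp]
      ring
    -- the limit is `∫ g dμ`
    have hint : ∫ z, g z ∂((RealRMK.rieszMeasure Λp).map ((↑) : U → ℂ)) = L gU := by
      rw [(MeasurableEmbedding.subtype_coe hU.measurableSet).integral_map, ← hΛp,
        ← RealRMK.integral_rieszMeasure Λp gU]
      simp only [hgUapp]
    rw [hint]
    exact (hconv gU).congr fun n => (hseq n).symm

/-- **Registered sub-goal `sideMeasure_weakStarLimit`** (crux item stmt-CriticalPhenomena-14004, line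
`polygon-parity-squeeze`, (A1c) of `stub_polygonIdentification`): weak-* subsequential limits of the
normalised positive boundary arrival measures of the spin-`0` observable from local mass bounds, in
registry form (one `∀`-term; see `sideMeasure_weakStarLimit_of_localMass`). [folklore] -/
theorem sideMeasure_weakStarLimit : ∀ (Λ : ℝ → Finset HexVertex) (a b : ℝ → Sym2 HexVertex) (U : Set ℂ), IsOpen U → (∀ K : Set ℂ, IsCompact K → K ⊆ U → ∃ C : ℝ, ∀ᶠ δ : ℝ in 𝓝[>] 0, δ * (∑ᶠ e ∈ {e : Sym2 HexVertex | e ∈ hexDomainBoundary (Λ δ) ∧ (δ : ℂ) * hexMidpoint e ∈ K}, ‖hexParafermionicObservable (Λ δ) (a δ) hexCriticalFugacity 0 e‖) ≤ C * ‖hexParafermionicObservable (Λ δ) (a δ) hexCriticalFugacity 0 (b δ)‖) → ∀ ns : ℕ → ℝ, Filter.Tendsto ns Filter.atTop (𝓝[>] 0) → ∃ ms : ℕ → ℕ, StrictMono ms ∧ ∃ μ : MeasureTheory.Measure ℂ, (∀ K : Set ℂ, IsCompact K → K ⊆ U → μ K < ⊤) ∧ ∀ g : ℂ → ℝ, Continuous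 g → HasCompactSupport g → tsupport g ⊆ U → Filter.Tendsto (fun n => ns (ms n) * ∑ᶠ e ∈ hexDomainBoundary (Λ (ns (ms n))), g ((ns (ms n) : ℂ) * hexMidpoint e) * (‖hexParafermionicObservable (Λ (ns (ms n))) (a (ns (ms n))) hexCriticalFugacity 0 e‖ / ‖hexParafermionicObservable (Λ (ns (ms n))) (a (ns (ms n))) hexCriticalFugacity 0 (b (ns (ms n)))‖)) Filter.atTop (𝓝 (∫ z, g z ∂μ)) :=
  fun Λ a b _ hU hM ns hns => sideMeasure_weakStarLimit_of_localMass Λ a b hU hM ns hns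

end Summit.CriticalPhenomena.SAWScalingLimit.Theorems.PolygonParitySqueeze

end
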